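import Literature.MathematicalPhysics.QuantumFieldTheory.Balaban1983to89.T4WordSystemGaugeBound

/-!
# `Balaban1983to89.B15Prop1HolonomyObstruction` — [Balaban1985Averaging] (8), (19)–(20) ∕ [Balaban1989LargeFieldII] p. 357: A BONDWISE NEAR-FLAT GAUGE ALONG A
# CLOSED WALK FORCES ITS HOLONOMY NEAR `1` — the kernel certificate of the lane's located shape-coverage statement LOCATED-GEOM v3 for the N12∕s1 gauge letter

Honest framing: statement-level skeleton of published theorems with citation tags; proofs where landed; nothing here is a claim about
the Yang–Mills mass gap.

Cell `pub-ymgap`, HUMAN RULINGS D-0062 ∕ D-0149, node N12 = [B15], lane-owner seat `pub-ymgap-dag-n12-c` (g19); count-neutral helper of K1⁹ `stmt-QuantumFields-27364`.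
Lattice gauge bookkeeping on the tree's own objects (`T4Continuum.walk` ∕ `holAt` ∕ `holAt_gaugeAct_walk`, `GaugeGroup.dist1_conj`, dag-n12-w2's
`T4WordSystemGaugeBound.dist1_holAt_le_length_mul`), any `GaugeGroup`.

THE POINT (cell bus 2026-08-28, LOCATED-GEOM v3).  The gauge letter (σ) of the N12∕s1 Proposition-1 endpoints (`B15Prop1EndpointFromLetterFamilies`,
`…N12Prop1OfGaugeLetterAndChartConstants` and their localised `_N`∕`Loc` editions) asks, per instance and for EVERY guarded base field, for ONE gauge transformation `σ` in which the
(2.12) minimiser `U₀` is bondwise `δc`-near `1` on the bonds of the `Ω₁(Z)`-touching plaquettes (conjunct C1), with ONE tolerance `δc i` capped by the numerics threshold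
(`B15Prop1NumericsThresholds`).  This file proves the elementary obstruction: if SOME gauge makes a configuration `U` bondwise `δ`-near `1` along a CLOSED walk `γ`, then the
(gauge-invariant) holonomy of `U` around `γ` is within `|γ|·δ` of `1` (§1–§2); contrapositively (§3), a configuration whose holonomy around `γ` is farther than `|γ|·δ` from `1`
admits NO such gauge — for any bond predicate `Q` covering the steps of `γ` (§4: the C1 shape).  Print's road is different ([Balaban1989LargeFieldII] p. 357 ll. 30–33 with
[Balaban1985Variational] Sect. F: LOCAL representations `U₀ = exp(iξA₀)` per cube, a covariant cube-localised (1.7)–(1.9)) and is untouched by this; the file only certifies which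
instances the tree's bondwise road can serve (components whose `Ω₁(Z)` is simply connected and normalisable: boxes, cube trees).

WHAT THIS FILE PROVES (theorems only — no `def`, no `instance`, no `sorry`; axioms standard):
* §1 `dist1_holAt_walk_gaugeAct_of_closed` — the holonomy of a CLOSED walk has gauge-invariant distance to `1`.
* §2 ★ `dist1_holAt_walk_le_length_mul_of_gauge` — a gauge bondwise `δ`-near `1` along a closed walk ⇒ `dist1 (𝒰_U(γ)) ≤ |γ|·δ`.
* §3 ★★ `not_exists_gauge_nearFlat_along_of_lt` — `|γ|·δ < dist1 (𝒰_U(γ))` ⇒ no gauge is bondwise `δ`-near `1` along `γ`.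
* §4 ★★ `not_exists_gauge_nearFlat_on_of_lt` — the same for any bond predicate `Q` covering the steps of `γ` (the C1 shape: «`∃ σ, ∀ b, Q b → dist1 ((U^σ) b) ≤ δ`» fails).

HONEST SCOPE.  A necessary condition on a DISPLAYED letter (like dag-n12-w6's `B15Prop1GaugeLetterGammaZeroPin` §3 for the `Γ₀` pin); nothing of Bałaban's asserted or refuted
(print's Prop. 1 stands for all shapes); count-neutral; N12 NOT discharged; K1⁹ NOT closed; one finite four-torus programme at fixed `ε = L^{-K}` — nothing continuum ∕ ℝ⁴ ∕ OS ∕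
mass gap ∕ Clay.

## References
* [Balaban1985Averaging] T. Bałaban, Commun. Math. Phys. 98 (1985) 17–51, (8) p. 18–19 (gauge transformation of parallel transport), (19)–(20) p. 21.
* [Balaban1989LargeFieldII] T. Bałaban, Commun. Math. Phys. 122 (1989) 355–392, p. 357 (the local representation `U₀ = exp(iξA₀)`), (1.7)–(1.9) p. 358.
-/

noncomputable section

namespace Literature.MathematicalPhysics.QuantumFieldTheory.Balaban1983to89.B15Prop1HolonomyObstruction

open T4Continuum
open T4WordSystemGaugeBound (dist1_holAt_le_length_mul)

variable {P : Params} {j : ℕ} {G : Type*} [GaugeGroup G]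

/-! ## §1  The holonomy of a closed walk is gauge invariant up to conjugation -/

/-- For a CLOSED walk `γ = walk x w` (`walkEnd x w = x`) the distance to `1` of the holonomy is gauge invariant:
`dist1 (𝒰_{U^σ}(γ)) = dist1 (𝒰_U(γ))` ([Balaban1985Averaging] (8): `𝒰_{U^σ}(γ) = σ(x)·𝒰_U(γ)·σ(x)⁻¹`, and `dist1` is conjugation invariant).
[cite: Balaban1985Averaging, (8) p.18, (12) p.19] -/
theorem dist1_holAt_walk_gaugeAct_of_closed (σ : GaugeTransf P j G) (U : GaugeField P j G) (x : Site P j) (w : List (Letter P.d))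
    (hw : walkEnd x w = x) :
    dist1 (holAt (GaugeField.gaugeAct σ U) (walk x w)) = dist1 (holAt U (walk x w)) := by
  rw [holAt_gaugeAct_walk, hw]
  exact GaugeGroup.dist1_conj _ _

/-! ## §2  Bondwise near-flatness along a closed walk bounds the holonomy -/

/-- ★ **A GAUGE BONDWISE `δ`-NEAR `1` ALONG A CLOSED WALK FORCES THE HOLONOMY WITHIN `|γ|·δ` OF `1`.**  If for some gauge transformation `σ` every step `s` of the closed walk
`γ = walk x w` has `dist1 ((U^σ)(s.bond)) ≤ δ` (`0 ≤ δ`), then `dist1 (𝒰_U(γ)) ≤ |γ|·δ`. [cite: Balaban1985Averaging, (8) p.18, (19)–(20) p.21] -/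
theorem dist1_holAt_walk_le_length_mul_of_gauge (U : GaugeField P j G) (x : Site P j) (w : List (Letter P.d)) (hw : walkEnd x w = x)
    {δ : ℝ} (hδ : 0 ≤ δ) (σ : GaugeTransf P j G) (h : ∀ s ∈ walk x w, dist1 (GaugeField.gaugeAct σ U s.bond) ≤ δ) :
    dist1 (holAt U (walk x w)) ≤ (walk x w).length * δ := by
  rw [← dist1_holAt_walk_gaugeAct_of_closed σ U x w hw]
  exact dist1_holAt_le_length_mul (GaugeField.gaugeAct σ U) hδ (walk x w) h

/-! ## §3  The obstruction -/

/-- ★★ **THE HOLONOMY OBSTRUCTION.**  If the holonomy of `U` around the closed walk `γ = walk x w` is farther than `|γ|·δ` from `1`, then NO gauge transformation makes `U`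
bondwise `δ`-near `1` along `γ`. [cite: Balaban1985Averaging, (8) p.18, (19)–(20) p.21; Balaban1989LargeFieldII, p.357 (why print represents `U₀` locally)] -/
theorem not_exists_gauge_nearFlat_along_of_lt (U : GaugeField P j G) (x : Site P j) (w : List (Letter P.d)) (hw : walkEnd x w = x)
    {δ : ℝ} (hδ : 0 ≤ δ) (hlt : (walk x w).length * δ < dist1 (holAt U (walk x w))) :
    ¬ ∃ σ : GaugeTransf P j G, ∀ s ∈ walk x w, dist1 (GaugeField.gaugeAct σ U s.bond) ≤ δ := by
  rintro ⟨σ, h⟩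
  exact absurd (dist1_holAt_walk_le_length_mul_of_gauge U x w hw hδ σ h) (not_le.mpr hlt)

/-! ## §4  The obstruction in the shape of the gauge letter's near-flatness conjunct -/

/-- ★★ **THE OBSTRUCTION FOR A BOND PREDICATE COVERING THE LOOP** (the shape of the N12∕s1 gauge letter's conjunct C1: «`∃ σ`, every bond `b` with `Q b` has
`dist1 ((U^σ) b) ≤ δ`», `Q` = «`b` is one of the four bonds of an `Ω₁(Z)`-touching plaquette»): if every step of a closed walk `γ` satisfies `Q` and the holonomy of `U`
around `γ` is farther than `|γ|·δ` from `1`, the conjunct is not inhabitable at `U` with tolerance `δ`.  For the lane: a `Z`-component whose `Ω₁(Z)` carries such a loop with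
a datum of large holonomy is outside the reach of the bondwise road (LOCATED-GEOM v3); print's per-cube representation is the road there.
[cite: Balaban1985Averaging, (8) p.18, (19)–(20) p.21; Balaban1989LargeFieldII, p.357] -/
theorem not_exists_gauge_nearFlat_on_of_lt (U : GaugeField P j G) (Q : PBond P j → Prop) (x : Site P j) (w : List (Letter P.d))
    (hw : walkEnd x w = x) (hQ : ∀ s ∈ walk x w, Q s.bond)
    {δ : ℝ} (hδ : 0 ≤ δ) (hlt : (walk x w).length * δ < dist1 (holAt U (walk x w))) :
    ¬ ∃ σ : GaugeTransf P j G, ∀ b : PBond P j, Q b → dist1 (GaugeField.gaugeAct σ U b) ≤ δ := by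
  rintro ⟨σ, h⟩
  exact not_exists_gauge_nearFlat_along_of_lt U x w hw hδ hlt ⟨σ, fun s hs => h s.bond (hQ s hs)⟩

/-- The same read positively: whenever the conjunct IS inhabited at tolerance `δ`, every closed walk through `Q`-bonds has holonomy within `|γ|·δ` of `1` — the floor
`δ ≥ dist1 (𝒰_U(γ)) ∕ |γ|` on any admissible tolerance. [cite: Balaban1985Averaging, (8) p.18, (19)–(20) p.21] -/
theorem dist1_holAt_walk_le_of_exists_gauge_nearFlat_on (U : GaugeField P j G) (Q : PBond P j → Prop) (x : Site P j) (w : List (Letter P.d))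
    (hw : walkEnd x w = x) (hQ : ∀ s ∈ walk x w, Q s.bond) {δ : ℝ} (hδ : 0 ≤ δ)
    (h : ∃ σ : GaugeTransf P j G, ∀ b : PBond P j, Q b → dist1 (GaugeField.gaugeAct σ U b) ≤ δ) :
    dist1 (holAt U (walk x w)) ≤ (walk x w).length * δ := by
  obtain ⟨σ, hσ⟩ := h
  exact dist1_holAt_walk_le_length_mul_of_gauge U x w hw hδ σ fun s hs => hσ s.bond (hQ s hs)

end Literature.MathematicalPhysics.QuantumFieldTheory.Balaban1983to89.B15Prop1HolonomyObstruction

end
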